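import Literature.IUT.HodgeArakelov.FlSymmetryConjGenuine
import Literature.IUT.HodgeArakelov.Rmk111ModelEmbeddingGenuine
import HarnessLib

/-!
# [IUTchII] Rmk. 1.1.1 (iii)–(iv) at the GENUINE [EtTh] frame, ALL CLAUSES FOR ONE `(W, T, Sec)`: the two sections and
# their difference (Def. 1.1 (ii)), the `𝔽_l^{⋊±}`-symmetry WITH THE CONJUGATION ACTIONS, and the model embedding

Mochizuki, *Inter-universal Teichmüller theory II*, §1, Remark 1.1.1 (iii), (iv), kurims manuscript (Dec. 2020) pp. 22–24
[claim: Mochizuki2012, status: disputed] (IUTchII §1 Rmk 1.1.1 (iv), kurims pp.23-24): (iii) «… by forming the difference of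
the two sections»; (iv) «this commutator map is equivariant with respect to these natural actions by `Π_C(M^Θ)` … the model
embedding `Π_{M^Θ} ↪ Π_μ(M^Θ) ⋊ Π_C(M^Θ)` may be reconstructed algorithmically»; [EtTh] Cor. 2.19 (i) p. 64
[cite: MochizukiEtTh2009, Cor 2.19(i) p.64].

abc-iut cell, layer L6, seat abc-iut-w4-d035 (gen 11), sequel of `FlSymmetryConjGenuine` (p468693, GAP row G-w4d018-1) taking
abc-iut-w4-d018 g7's offer «RMK111-ALL-CLAUSES-GENUINE» (STATUS 21:16:51Z, first refusal to this seat). PROOF-ONLY (0 `def`).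
* **`ModelFrame.exists_flSymmetry_conj_of_pinned`** — the REUSABLE form of p468693's assembly: for ANY core tower `W`
  identified with `Π^tp_C` (`j`, `Δ_C(M) = Ker(augC ∘ j)`, abc-iut-w5-d225's `hWker`, the two `𝔽_l^{⋊±}` clauses), the model
  theta-quotient datum `T` and ANY two-sections datum `Sec : TwoSections T W` pinned by (P1)/(P2)/(P3) (p465659), there is
  `Φ : FlSymmetry Sec` whose three action fields are the conjugation actions (p459254 / p467696) with their pins — so that
  consumers holding their own pinned `Sec` (e.g. together with the Def. 1.1 (ii) datum `C′` of p448420/p465659) get the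
  genuine symmetry record for THAT `Sec`.
* **`ModelFrame.exists_rmk111_allClauses_genuine`** — ONE tuple `(W, j, T, Sec, C′, Φ, φ)` at the genuine frame carrying
  EVERY clause of Rmk. 1.1.1 (iii)–(iv): `rigidity_is_difference Sec C′` with `C′.iso = (B8 iso)⁻¹` (abc-iut-w4-d043 p448420 via
  p465659), the commutator pin (P3), `Φ : FlSymmetry Sec` with the conjugation pins, and `Rmk111_iv_modelEmbedding … W φ` for the
  GENUINE `φ` = cyclotomic character of `augC ∘ j` on `Π_μ(M) ≅ μ_N` (abc-iut-w4-d018 g7 p468601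
  `rmk111_iv_modelEmbedding_holds`, BY NAME).
BINDER CENSUS (BY NAME, no `Prop` fact introduced, no FACT-LIST row consumed): `cl`, C4 `cl.InvActsByNegOnEll`, `IsEtThOrigin`,
`hYcl`, (R1c) `hR1c`, `hker`, `hlS : S.l = l`, `l` prime, a theta cocycle `η`. HONEST FRAMING: kernel facts about the cell's own
typed interfaces and model; constructed ≠ endorsed; Rmk. 1.1.1 is outside the [IUTchIII] Cor. 3.12 cone; no side taken on
Cor. 3.12; typed ≠ proved; nothing here asserts abc proved or refuted.
-/

noncomputable section

namespace Literature.IUT.HodgeArakelov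

open Literature.AnabelianGeometry.EtaleTheta Literature.AnabelianGeometry.SemiGraphs
open scoped Literature.AnabelianGeometry.EtaleTheta

namespace ModelFrame

variable {p : ℕ} [Fact p.Prime] {Mt : MuTwoSetting p}
  {E : Mt.toThetaSetting.EtaleThetaData} {l : ℕ} (C : E.DoubleUnderline l)
  {S : ThetaSetting.{0}} (μ : Mt.toThetaSetting.CyclotomeMod l S.N)
  (hC : Mt.toThetaSetting.Compat) (hS : Mt.toThetaSetting.Sec2Hyps)
  (h15 : ThetaSetting.Prop15iii E hC) (L : C.CuspLabels)
  (F : ModelFrame S (C.rigidData μ hC hS h15 L)) {Menv : MonoThetaEnv S}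
  (e : Menv.Pi ≃ₜ* (C.rigidData μ hC hS h15 L).env) (cl : Mt.CLevelData)

/-- **IUTchII:Rmk1.1.1(iv) — the conjugation `FlSymmetry` for ANY pinned two-sections datum** (reusable form of
`exists_flSymmetry_conj_genuine`): given a core tower `W` identified with `Π^tp_C` (`j`; `Δ_C(M) = Ker(augC ∘ j)`; `hWker`;
the two `𝔽_l^{⋊±}` clauses), the model theta-quotient datum `T` and a two-sections datum `Sec` pinned by (P1)/(P2)/(P3), there
is `Φ : FlSymmetry Sec` with `Φ.act`, `Φ.actlZ`, `Φ.actEll` the conjugation actions (pins through the model embedding,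
`toZ`, `(Π^tp_X)^ell`); `Φ.commutator_equivariant` is the printed equivariance clause for the genuine actions.
[claim: Mochizuki2012, status: disputed] (IUTchII §1 Rmk 1.1.1 (iv), kurims pp.23-24) -/
theorem exists_flSymmetry_conj_of_pinned (hinv : cl.InvActsByNegOnEll) (hO : Mt.toThetaSetting.IsEtThOrigin)
    (hYcl : (Mt.DtpY.map Mt.toHat.toMonoidHom).topologicalClosure ≤
      Mt.DtpY.map Mt.toHat.toMonoidHom ⊔ (⁅⁅Mt.DeltaHat, Mt.DeltaHat⁆, Mt.DeltaHat⁆).topologicalClosure)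
    (hR1c : ∀ x : Mt.PiTemp, Mt.toZ (cl.conjX Mt.epsPM x) = (Mt.toZ x)⁻¹)
    (hker : Mt.toTheta.ker ≤ C.Huu) (hlS : S.l = l) (hl : l.Prime)
    {η : (C.rigidData μ hC hS h15 L).PiYdd → (C.rigidData μ hC hS h15 L).mu}
    (hη : η ∈ (C.rigidData μ hC hS h15 L).thetaCocycles)
    (W : CoreTower (F.reconstruction e)) (j : W.PiC ≃* Mt.GtpC)
    (hDeltaC : ∀ c : W.PiC, c ∈ W.DeltaC ↔ cl.augC (j c) = 1)
    (hWker : W.kerEll = ((Mt.thetaToEll.comp Mt.toTheta).ker).comap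
      (C.Huu.subtype.comp (Mt.GtpY.subgroupOf C.Huu).subtype))
    (hN : (W.DeltaXplain.subgroupOf W.DeltaC).Normal)
    (hq : Nonempty (W.DeltaC ⧸ W.DeltaXplain.subgroupOf W.DeltaC ≃* Literature.IUT.HodgeTheaters.FlPM l))
    (T : ThetaQuotientData (F.reconstruction e))
    (hT : T.thetaSection = (((C.rigidData μ hC hS h15 L).thetaKer.subgroupOf (C.rigidData μ hC hS h15 L).PiY).map
      (CycEnvelope.algSection (C.rigidData μ hC hS h15 L).augY (C.rigidData μ hC hS h15 L).chi)).comap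
        e.toMulEquiv.toMonoidHom)
    (Sec : TwoSections T W)
    (hP1 : ∀ g : ↥(C.rigidData μ hC hS h15 L).lDeltaTheta,
      ∃ hg : e.symm ((C.rigidData μ hC hS h15 L).toThetaEnvData.sTheta hη
          ⟨(g : (C.rigidData μ hC hS h15 L).PiX),
            (Subgroup.mem_inf.1 ((C.rigidData μ hC hS h15 L).lDeltaTheta_le g.2)).1⟩) ∈ T.envAtTheta.top,
        (QuotientGroup.mk (⟨_, hg⟩ : ↥T.envAtTheta.top) : T.envAtTheta.carrier) ∈ Sec.sTheta)
    (hP2 : ∀ s ∈ Sec.sAlg, ∃ (g : ↥(C.rigidData μ hC hS h15 L).lDeltaTheta)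
      (hg : e.symm ((C.rigidData μ hC hS h15 L).toThetaEnvData.sAlg
          ⟨(g : (C.rigidData μ hC hS h15 L).PiX),
            (Subgroup.mem_inf.1 ((C.rigidData μ hC hS h15 L).lDeltaTheta_le g.2)).1⟩) ∈ T.envAtTheta.top),
        s = (QuotientGroup.mk (⟨_, hg⟩ : ↥T.envAtTheta.top) : T.envAtTheta.carrier))
    (hP3 : ∀ (x : ↥C.Huu) (_hx : Mt.aug (x : Mt.PiTemp) = 1) (b : ↥(F.reconstruction e).DeltaY),
        ∃ (hmem : x * ((b : ↥(Mt.GtpY.subgroupOf C.Huu)) : ↥C.Huu) * x⁻¹ *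
              (((b : ↥(Mt.GtpY.subgroupOf C.Huu)) : ↥C.Huu))⁻¹ ∈ (C.rigidData μ hC hS h15 L).lDeltaTheta)
          (hg : e.symm ((C.rigidData μ hC hS h15 L).toThetaEnvData.sAlg
            ⟨((⟨_, hmem⟩ : ↥(C.rigidData μ hC hS h15 L).lDeltaTheta) : (C.rigidData μ hC hS h15 L).PiX),
              (Subgroup.mem_inf.1 ((C.rigidData μ hC hS h15 L).lDeltaTheta_le hmem)).1⟩) ∈ T.envAtTheta.top),
          Sec.commutator (QuotientGroup.mk x : ↥C.Huu ⧸ (F.reconstruction e).inclY.range)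
              (QuotientGroup.mk b : W.DeltaYell) =
            (QuotientGroup.mk (⟨_, hg⟩ : ↥T.envAtTheta.top) : T.envAtTheta.carrier)) :
    ∃ Φ : FlSymmetry Sec,
      (∀ (c : W.PiC) (u v : ↥T.envAtTheta.top),
          (e (v : Menv.Pi)).left = galMuN p S.N (cl.augC (j c)) (e (u : Menv.Pi)).left →
          ((((e (v : Menv.Pi)).right : ↥(C.rigidData μ hC hS h15 L).PiY) : ↥C.Huu) : Mt.PiTemp) =
            cl.conjX (j c) ((((e (u : Menv.Pi)).right : ↥(C.rigidData μ hC hS h15 L).PiY) : ↥C.Huu) : Mt.PiTemp) →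
          Φ.act c (QuotientGroup.mk u) = QuotientGroup.mk v) ∧
      (∀ c : W.PiC, cl.augC (j c) = 1 → Φ.act c = 1) ∧
      (∀ (c : W.PiC) (x x' : ↥C.Huu),
          (QuotientGroup.mk x' : ↥C.Huu ⧸ (F.reconstruction e).inclY.range) =
            Φ.actlZ c (QuotientGroup.mk x : ↥C.Huu ⧸ (F.reconstruction e).inclY.range) →
          Mt.toZ (x' : Mt.PiTemp) = Mt.toZ (cl.conjX (j c) (x : Mt.PiTemp))) ∧
      (∀ c : W.PiC, (j c ∈ Mt.inclX.range → Φ.actlZ c = 1) ∧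
        (j c ∉ Mt.inclX.range → ∀ a : (F.reconstruction e).lZ, Φ.actlZ c a = a⁻¹)) ∧
      (∀ (c : W.PiC) (b b' : ↥(F.reconstruction e).DeltaY),
        (QuotientGroup.mk b' : W.DeltaYell) = Φ.actEll c (QuotientGroup.mk b) →
        Mt.thetaToEll (Mt.toTheta (((b' : ↥(Mt.GtpY.subgroupOf C.Huu)) : ↥C.Huu) : Mt.PiTemp)) =
          Mt.thetaToEll (Mt.toTheta (cl.conjX (j c) (((b : ↥(Mt.GtpY.subgroupOf C.Huu)) : ↥C.Huu) : Mt.PiTemp)))) := by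
  classical
  set R : RigidData S.N l := C.rigidData μ hC hS h15 L with hRdef
  obtain ⟨act, hpin, hex, hfac⟩ := exists_conjAct C μ hC hS h15 L F e cl hinv hO hYcl hker T hT
  obtain ⟨actlZ, hlZpin, hlZ1, hlZι⟩ := exists_conjActlZ C μ hC hS h15 L F e cl hR1c
  haveI hdYn : (W.kerEll.subgroupOf (F.reconstruction e).DeltaY).Normal := W.deltaEll_normal
  obtain ⟨actEll, hEll⟩ := exists_conjActEll C μ hC hS h15 L F e cl hR1c hO hYcl hker hl W hWker
  have hq' : Nonempty (W.DeltaC ⧸ W.DeltaXplain.subgroupOf W.DeltaC ≃* Literature.IUT.HodgeTheaters.FlPM S.l) := by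
    rw [hlS]; exact hq
  /- ### §3. Equivariance of the commutator map -/
  haveI hinclYn : (F.reconstruction e).inclY.range.Normal := (F.reconstruction e).inclY_normal
  have haugR : ∀ x : ↥C.Huu, x ∈ R.aug.ker ↔ Mt.aug (x : Mt.PiTemp) = 1 := fun x => by
    rw [MonoidHom.mem_ker, ← OneMemClass.coe_eq_one]; rfl
  have hΔY : ∀ y : ↥(F.reconstruction e).DeltaY,
      Mt.aug (((y : ↥(Mt.GtpY.subgroupOf C.Huu)) : ↥C.Huu) : Mt.PiTemp) = 1 := fun y =>
    (mem_deltaY_reconstruction_iff C μ hC hS h15 L F e y.1).1 y.2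
  have hxrep : ∀ a : (F.reconstruction e).lZ, ∃ x : ↥C.Huu,
      (QuotientGroup.mk x : ↥C.Huu ⧸ (F.reconstruction e).inclY.range) = a ∧ Mt.aug (x : Mt.PiTemp) = 1 := by
    intro a
    obtain ⟨x₀, rfl⟩ := QuotientGroup.mk_surjective a
    obtain ⟨y, hy⟩ := ModelCyclotomes.augY_surjective R (R.aug x₀)
    refine ⟨x₀ * (y : ↥C.Huu)⁻¹, ?_, ?_⟩
    · refine (QuotientGroup.eq.2 ?_).symm
      rw [← mul_assoc, inv_mul_cancel, one_mul]; exact inv_mem ⟨y, rfl⟩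
    · rw [← haugR, MonoidHom.mem_ker, map_mul, map_inv, mul_inv_eq_one]; exact hy.symm
  have htopA : ∀ g : ↥R.lDeltaTheta, e.symm (R.toThetaEnvData.sAlg
      ⟨(g : R.PiX), (Subgroup.mem_inf.1 (R.lDeltaTheta_le g.2)).1⟩) ∈ T.envAtTheta.top := by
    intro g
    change (((e (e.symm _)).right : ↥C.Huu)) ∈ R.lDeltaTheta
    rw [ContinuousMulEquiv.apply_symm_apply]
    exact g.2
  have hleftA : ∀ x : ↥R.PiYdd, (R.toThetaEnvData.sAlg x).left = 1 := fun _ => rfl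
  have hrightA : ∀ x : ↥R.PiYdd, (((R.toThetaEnvData.sAlg x).right : ↥C.Huu) : Mt.PiTemp) = ((x : R.PiX) : Mt.PiTemp) :=
    fun _ => rfl
  have hequiv : ∀ (c : W.PiC) (a : (F.reconstruction e).lZ) (y : W.DeltaYell),
      Sec.commutator (actlZ (j c) a) (actEll (j c) y) = act (j c) (Sec.commutator a y) := by
    intro c₀ a y
    set c : Mt.GtpC := j c₀ with hcdef
    obtain ⟨x, rfl, hx⟩ := hxrep a
    obtain ⟨b, rfl⟩ := QuotientGroup.mk_surjective y
    obtain ⟨x', hx'a, hx'⟩ := hxrep (actlZ c (QuotientGroup.mk x))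
    obtain ⟨b', hb'y⟩ := QuotientGroup.mk_surjective (actEll c (QuotientGroup.mk b : W.DeltaYell))
    rw [← hx'a, ← hb'y]
    -- both commutators through (P3)
    obtain ⟨hmem, hg, hcomm⟩ := hP3 x hx b
    obtain ⟨hmem', hg', hcomm'⟩ := hP3 x' hx' b'
    rw [hcomm, hcomm']
    -- the right-hand side through `conjAct_mk_sAlg`
    set g : ↥R.lDeltaTheta := ⟨_, hmem⟩ with hgdef
    set g' : ↥R.lDeltaTheta := ⟨_, hmem'⟩ with hg'def
    let g'' : ↥R.lDeltaTheta := ⟨⟨cl.conjX c ((g : ↥C.Huu) : Mt.PiTemp),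
        C.conjX_mem_Huu_of_mem_lDeltaTheta μ hC hS h15 L cl hker c _ g.2⟩,
      C.conjX_mem_lDeltaTheta μ hC hS h15 L cl hker c _ g.2⟩
    have hgg'' : ((g'' : ↥C.Huu) : Mt.PiTemp) = cl.conjX c ((g : ↥C.Huu) : Mt.PiTemp) := rfl
    rw [conjAct_mk_sAlg C μ hC hS h15 L F e cl T act hpin c g g'' hgg'' hg (htopA g'')]
    -- same class: same `μ_N`-coordinate (`1`) and same image in `(Π^tp_X)^Θ` (pairing lemma)
    apply envAtTheta_mk_eq_of_toTheta_eq C μ hC hS h15 L F e T hT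
    · change (e (e.symm _)).left = (e (e.symm _)).left
      rw [ContinuousMulEquiv.apply_symm_apply, ContinuousMulEquiv.apply_symm_apply, hleftA, hleftA]
    · change Mt.toTheta ((((e (e.symm _)).right : ↥R.PiY) : ↥C.Huu) : Mt.PiTemp) =
        Mt.toTheta ((((e (e.symm _)).right : ↥R.PiY) : ↥C.Huu) : Mt.PiTemp)
      rw [ContinuousMulEquiv.apply_symm_apply, ContinuousMulEquiv.apply_symm_apply, hrightA, hrightA, hgg'']
      -- unfold the two commutators as products in `Π^tp_X`
      have e1 : (((g' : ↥R.lDeltaTheta) : R.PiX) : Mt.PiTemp) =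
          (x' : Mt.PiTemp) * (((b' : ↥(Mt.GtpY.subgroupOf C.Huu)) : ↥C.Huu) : Mt.PiTemp) * (x' : Mt.PiTemp)⁻¹ *
            ((((b' : ↥(Mt.GtpY.subgroupOf C.Huu)) : ↥C.Huu) : Mt.PiTemp))⁻¹ := rfl
      have e2 : (((g : ↥R.lDeltaTheta) : R.PiX) : Mt.PiTemp) =
          (x : Mt.PiTemp) * (((b : ↥(Mt.GtpY.subgroupOf C.Huu)) : ↥C.Huu) : Mt.PiTemp) * (x : Mt.PiTemp)⁻¹ *
            ((((b : ↥(Mt.GtpY.subgroupOf C.Huu)) : ↥C.Huu) : Mt.PiTemp))⁻¹ := rfl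
      rw [e1, e2]
      have hb'Y : (((b' : ↥(Mt.GtpY.subgroupOf C.Huu)) : ↥C.Huu) : Mt.PiTemp) ∈ Mt.DtpY :=
        ⟨Subgroup.mem_subgroupOf.1 (b' : ↥(Mt.GtpY.subgroupOf C.Huu)).2, hΔY b'⟩
      have key := Mt.toThetaSetting.toTheta_conjComm_eq_of_toZ_eq_of_thetaToEll_eq hO hx'
        ((cl.conjX_mem_deltaTemp_iff c _).2 hx) (hlZpin c x x' hx'a) hb'Y (hEll c b b' hb'y)
      simp only [map_mul, map_inv] at key ⊢
      exact key
  /- ### §4. Assembly -/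
  refine
    ⟨{ act := act.comp j.toMonoidHom
       act_factors := fun c hc => ?_
       abelian := envAtTheta_mul_comm F e T hT
       actlZ := actlZ.comp j.toMonoidHom
       actEll := actEll.comp j.toMonoidHom
       commutator_equivariant := fun c a y => hequiv c a y
       sTheta_stable := fun c =>
         sTheta_map_conjAct_eq C μ hC hS h15 L F e cl hinv hO hYcl hker T Sec hη hP1 act hpin (j c)
       sAlg_stable := fun c => sAlg_map_conjAct_eq C μ hC hS h15 L F e cl hker T hT Sec hP2 act hpin (j c)
       deltaX_normal := hN
       quot_iso_Fl := hq' },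
     fun c => hpin (j c), fun c hc => hfac (j c) hc, fun c => hlZpin (j c), fun c => ⟨hlZ1 (j c), hlZι (j c)⟩,
     fun c => hEll (j c)⟩
  rw [MonoidHom.mem_ker]
  exact hfac (j c) ((hDeltaC c).1 hc)

/-- **IUTchII:Rmk1.1.1(iii)–(iv), ALL CLAUSES AT THE GENUINE FRAME FOR ONE `(W, T, Sec)`**: the genuine core tower `W`
(p466913; `j : Π_C(M) ≃* Π^tp_C`, `Δ_C(M) = Ker(augC ∘ j)`, `j ∘ isoXbarbar = inclX`, `kerEll` pin, `W.PiC = Π^tp_C`), the model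
theta-quotient datum `T`, a two-sections datum `Sec` with the Def. 1.1 (ii) datum `C′ = (B8 iso)⁻¹` such that
`rigidity_is_difference Sec C′` HOLDS and the commutator map is the genuine one (P3) (p465659 / p448420), `Φ : FlSymmetry Sec`
with the CONJUGATION actions (`exists_flSymmetry_conj_of_pinned`), and the GENUINE `φ` (cyclotomic character of `augC ∘ j` on
`Π_μ(M)`) for which `Rmk111_iv_modelEmbedding (F.reconstruction e) W φ` holds (p468601).
[claim: Mochizuki2012, status: disputed] (IUTchII §1 Rmk 1.1.1 (iv), kurims pp.22-24) -/
theorem exists_rmk111_allClauses_genuine (hinv : cl.InvActsByNegOnEll) (hO : Mt.toThetaSetting.IsEtThOrigin)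
    (hYcl : (Mt.DtpY.map Mt.toHat.toMonoidHom).topologicalClosure ≤
      Mt.DtpY.map Mt.toHat.toMonoidHom ⊔ (⁅⁅Mt.DeltaHat, Mt.DeltaHat⁆, Mt.DeltaHat⁆).topologicalClosure)
    (hR1c : ∀ x : Mt.PiTemp, Mt.toZ (cl.conjX Mt.epsPM x) = (Mt.toZ x)⁻¹)
    (hker : Mt.toTheta.ker ≤ C.Huu) (hlS : S.l = l) (hl : l.Prime)
    {η : (C.rigidData μ hC hS h15 L).PiYdd → (C.rigidData μ hC hS h15 L).mu}
    (hη : η ∈ (C.rigidData μ hC hS h15 L).thetaCocycles) :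
    ∃ (W : CoreTower (F.reconstruction e)) (j : W.PiC ≃* Mt.GtpC) (T : ThetaQuotientData (F.reconstruction e))
      (Sec : TwoSections T W) (C' : CyclotomicRigidity (F.reconstruction e)) (Φ : FlSymmetry Sec)
      (φ : W.PiC →* MulAut (F.reconstruction e).extCyc),
      -- the tower
      (∀ c : W.PiC, c ∈ W.DeltaC ↔ cl.augC (j c) = 1) ∧
      (∀ x : ↥C.Huu, j ((W.isoXbarbar x : ↥W.Xbarbar) : W.PiC) = Mt.inclX (x : Mt.PiTemp)) ∧
      W.kerEll = ((Mt.thetaToEll.comp Mt.toTheta).ker).comap (C.Huu.subtype.comp (Mt.GtpY.subgroupOf C.Huu).subtype) ∧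
      W.PiC = TopGroup.of Mt.GtpC ∧
      -- (ii)/(iii): the model theta section, the two sections and their difference
      T.thetaSection = (((C.rigidData μ hC hS h15 L).thetaKer.subgroupOf (C.rigidData μ hC hS h15 L).PiY).map
          (CycEnvelope.algSection (C.rigidData μ hC hS h15 L).augY (C.rigidData μ hC hS h15 L).chi)).comap
          e.toMulEquiv.toMonoidHom ∧
      (∀ c, ((C'.iso c : ↥(F.reconstruction e).extCyc) : Menv.Pi) =
        (((F.cyclotomicRigidity e).iso c : ↥(F.reconstruction e).extCyc) : Menv.Pi)⁻¹) ∧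
      rigidity_is_difference Sec C' ∧
      (∀ (x : ↥C.Huu) (_hx : Mt.aug (x : Mt.PiTemp) = 1) (b : ↥(F.reconstruction e).DeltaY),
        ∃ (hmem : x * ((b : ↥(Mt.GtpY.subgroupOf C.Huu)) : ↥C.Huu) * x⁻¹ *
              (((b : ↥(Mt.GtpY.subgroupOf C.Huu)) : ↥C.Huu))⁻¹ ∈ (C.rigidData μ hC hS h15 L).lDeltaTheta)
          (hg : e.symm ((C.rigidData μ hC hS h15 L).toThetaEnvData.sAlg
            ⟨((⟨_, hmem⟩ : ↥(C.rigidData μ hC hS h15 L).lDeltaTheta) : (C.rigidData μ hC hS h15 L).PiX),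
              (Subgroup.mem_inf.1 ((C.rigidData μ hC hS h15 L).lDeltaTheta_le hmem)).1⟩) ∈ T.envAtTheta.top),
          Sec.commutator (QuotientGroup.mk x : ↥C.Huu ⧸ (F.reconstruction e).inclY.range)
              (QuotientGroup.mk b : W.DeltaYell) =
            (QuotientGroup.mk (⟨_, hg⟩ : ↥T.envAtTheta.top) : T.envAtTheta.carrier)) ∧
      -- (iv): the three conjugation actions of `Φ`
      (∀ (c : W.PiC) (u v : ↥T.envAtTheta.top),
          (e (v : Menv.Pi)).left = galMuN p S.N (cl.augC (j c)) (e (u : Menv.Pi)).left →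
          ((((e (v : Menv.Pi)).right : ↥(C.rigidData μ hC hS h15 L).PiY) : ↥C.Huu) : Mt.PiTemp) =
            cl.conjX (j c) ((((e (u : Menv.Pi)).right : ↥(C.rigidData μ hC hS h15 L).PiY) : ↥C.Huu) : Mt.PiTemp) →
          Φ.act c (QuotientGroup.mk u) = QuotientGroup.mk v) ∧
      (∀ c : W.PiC, cl.augC (j c) = 1 → Φ.act c = 1) ∧
      (∀ (c : W.PiC) (x x' : ↥C.Huu),
          (QuotientGroup.mk x' : ↥C.Huu ⧸ (F.reconstruction e).inclY.range) =
            Φ.actlZ c (QuotientGroup.mk x : ↥C.Huu ⧸ (F.reconstruction e).inclY.range) →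
          Mt.toZ (x' : Mt.PiTemp) = Mt.toZ (cl.conjX (j c) (x : Mt.PiTemp))) ∧
      (∀ c : W.PiC, (j c ∈ Mt.inclX.range → Φ.actlZ c = 1) ∧
        (j c ∉ Mt.inclX.range → ∀ a : (F.reconstruction e).lZ, Φ.actlZ c a = a⁻¹)) ∧
      (∀ (c : W.PiC) (b b' : ↥(F.reconstruction e).DeltaY),
        (QuotientGroup.mk b' : W.DeltaYell) = Φ.actEll c (QuotientGroup.mk b) →
        Mt.thetaToEll (Mt.toTheta (((b' : ↥(Mt.GtpY.subgroupOf C.Huu)) : ↥C.Huu) : Mt.PiTemp)) =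
          Mt.thetaToEll (Mt.toTheta (cl.conjX (j c) (((b : ↥(Mt.GtpY.subgroupOf C.Huu)) : ↥C.Huu) : Mt.PiTemp)))) ∧
      -- (iv)-E: the model embedding for the genuine action `φ`
      (∀ (c : W.PiC) (m : ↥(F.reconstruction e).extCyc),
        φ c m = extEquiv e (galMuN p S.N (cl.augC (j c)) ((extEquiv e).symm m))) ∧
      Rmk111_iv_modelEmbedding (F.reconstruction e) W φ := by
  obtain ⟨W, j, hDeltaC, hjiso, -, -, -, hWker, hPiC, hN, hq⟩ :=
    exists_coreTower_pinned_of_cLevelData C μ hC hS h15 L F e cl hO hYcl hR1c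
  obtain ⟨T, Sec, C', hT, hC', hdiff, hP1, hP2, hP3⟩ :=
    exists_twoSections_pinned_of_coreTower C μ hC hS h15 L F e hO hYcl hη W hWker
  obtain ⟨Φ, hact, hfac, hlZ, hlZ', hEll⟩ := exists_flSymmetry_conj_of_pinned C μ hC hS h15 L F e cl hinv hO hYcl hR1c hker
    hlS hl hη W j hDeltaC hWker hN hq T hT Sec hP1 hP2 hP3
  let φ : W.PiC →* MulAut (F.reconstruction e).extCyc :=
    (MulAut.congr (extEquiv e)).toMonoidHom.comp ((galMuN p S.N).comp (cl.augC.toMonoidHom.comp j.toMonoidHom))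
  have hφ : ∀ (c : W.PiC) (m : ↥(F.reconstruction e).extCyc),
      φ c m = extEquiv e (galMuN p S.N (cl.augC (j c)) ((extEquiv e).symm m)) := fun _ _ => rfl
  exact ⟨W, j, T, Sec, C', Φ, φ, hDeltaC, hjiso, hWker, hPiC, hT, hC', hdiff, hP3, hact, hfac, hlZ, hlZ', hEll, hφ,
    rmk111_iv_modelEmbedding_holds F e W φ⟩

end ModelFrame

end Literature.IUT.HodgeArakelov

end
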